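import Summits.HodgeConjecture.CorCM.Census.CentralSquaresDihedralFibre

/-!
# The square-central class, XII: the split extensions `N ⋊ D₄` — `μ = φ₂ = β − 2`

COR-CM (cell `pub-hodgecm2`), count-neutral kernel combinatorics by the binder seat b09 (gen 45; lane SQUARE-CENTRAL CLASS, part XII), on parts X–XI
(`isLeast_card_gfaces_generate_of_dihedral_quotient_block`, `fibreTwo_add_two_eq_card_block_of_dihedral_quotient`), BY NAME, and Mathlibʼs
`SemidirectProduct` (`rightHom`, `range_inl_eq_ker_rightHom`, `card`).  Theorems only; small `decide`s on `D₄`; no certificate, no named fact, no `sorry`.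
HONEST FRAMING: `HC_CM` is NOT proved, here or anywhere in the tree; nothing here is a period or a headline.

For a finite group `N` of order `2ᵏ` and an action `φ : D₄ →* MulAut N` in which `r²` acts trivially, the split extension `G = N ⋊[φ] D₄` with the central
involution `c = inr r²` is a dihedral quotient row (`rightHom : G ↠ D₄`, kernel `inl N`, `inr s` an involution over `s`):
* `fibreTwo_add_two_eq_card_block_semidirect`: **`φ₂(G, c) + 2 = β(G, c)`** (every `k`);
* `isLeast_card_gfaces_generate_semidirect[_block]`: **`μ(G, c) = φ₂(G, c) = β(G, c) − 2`** for `k ≥ 2`.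
The direct products `D₄ × E` of part IX are the case `φ = 1`; new rows include `ℤ/4 ⋊ D₄` (`s` inverting), `(ℤ/2)² ⋊ D₄` (`s` swapping), of order `32`.
The `Fintype` structure on `N ⋊[φ] D₄` is taken as an instance argument (Mathlib derives only `DecidableEq`; any instance, e.g.
`Fintype.ofEquiv _ SemidirectProduct.equivProd.symm`, will do).

## References
* [Pohlmann1968] H. Pohlmann, Algebraic cycles on abelian varieties of complex multiplication type, Ann. of Math. 88 (1968), Thm 1.
* [Milne1999] J. S. Milne, Lefschetz motives and the Tate conjecture, Compositio Math. 117 (1999), Prop. 2.1, p. 54.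
-/

namespace Summit.HodgeConjecture.CorCM.Census.CentralSquares

open Finset DihedralGroup
open Summit.HodgeConjecture.CorCM.Prior.AllgGroup.RfwfAllgGroup
open Summit.HodgeConjecture.CorCM.Census.BlockParity
open Summit.HodgeConjecture.CorCM.Census.Coinvariant
open Summit.HodgeConjecture.CorCM.Census.TwistGeneration
open Summit.HodgeConjecture.CorCM.Census.BaseBlock

noncomputable section

/-- `c² = 1` for `c = inr r²` in `N ⋊[φ] D₄`. [folklore] -/
theorem semidirect_c_mul_c (N : Type*) [Group N] (φ : DihedralGroup 4 →* MulAut N) :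
    (SemidirectProduct.inr (r 2) : N ⋊[φ] DihedralGroup 4) * SemidirectProduct.inr (r 2) = 1 := by
  rw [← map_mul, show (r 2 : DihedralGroup 4) * r 2 = 1 by decide, map_one]

/-- `c = inr r²` is central in `N ⋊[φ] D₄` when `r²` acts trivially on `N`. [folklore] -/
theorem semidirect_c_central (N : Type*) [Group N] (φ : DihedralGroup 4 →* MulAut N) (hφ : φ (r 2) = 1)
    (x : N ⋊[φ] DihedralGroup 4) : x * SemidirectProduct.inr (r 2) = SemidirectProduct.inr (r 2) * x := by
  have h : ∀ d : DihedralGroup 4, d * r 2 = r 2 * d := by decide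
  ext
  · simp only [SemidirectProduct.mul_left, SemidirectProduct.left_inr, map_one, mul_one, SemidirectProduct.right_inr, hφ,
      MulAut.one_apply, one_mul]
  · simp only [SemidirectProduct.mul_right, SemidirectProduct.right_inr]
    exact h _

/-- `N ⋊[φ] D₄` is a `2`-group when `|N| = 2ᵏ`. [folklore] -/
theorem semidirect_isPGroup (N : Type*) [Group N] [Fintype N] (φ : DihedralGroup 4 →* MulAut N) (k : ℕ)
    (hN : Fintype.card N = 2 ^ k) : IsPGroup 2 (N ⋊[φ] DihedralGroup 4) := by
  refine IsPGroup.of_card (n := k + 3) ?_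
  rw [SemidirectProduct.card]; simp only [Nat.card_eq_fintype_card]; rw [hN, DihedralGroup.card]; ring

/-- The kernel of `rightHom : N ⋊[φ] D₄ ↠ D₄` has `|N|` elements. [folklore] -/
theorem semidirect_card_ker (N : Type*) [Group N] [Fintype N] (φ : DihedralGroup 4 →* MulAut N) :
    Nat.card (SemidirectProduct.rightHom : N ⋊[φ] DihedralGroup 4 →* DihedralGroup 4).ker = Fintype.card N := by
  rw [← SemidirectProduct.range_inl_eq_ker_rightHom, ← Nat.card_eq_fintype_card]
  exact Nat.card_congr (MonoidHom.ofInjective SemidirectProduct.inl_injective).toEquiv.symm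

/-- **`φ₂ + 2 = β` for the split extensions `(N ⋊[φ] D₄, inr r²)`**, `|N| = 2ᵏ`, `r²` acting trivially. [folklore] -/
theorem fibreTwo_add_two_eq_card_block_semidirect (N : Type*) [Group N] [Fintype N] [DecidableEq N]
    (φ : DihedralGroup 4 →* MulAut N) (hφ : φ (r 2) = 1) [Fintype (N ⋊[φ] DihedralGroup 4)] (k : ℕ) (hN : Fintype.card N = 2 ^ k) :
    fibreTwo (SemidirectProduct.inr (r 2) : N ⋊[φ] DihedralGroup 4) (semidirect_c_mul_c N φ) + 2 =
      Fintype.card (Block (SemidirectProduct.inr (r 2) : N ⋊[φ] DihedralGroup 4)) :=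
  fibreTwo_add_two_eq_card_block_of_dihedral_quotient (semidirect_isPGroup N φ k hN) (semidirect_c_mul_c N φ)
    (semidirect_c_central N φ hφ) SemidirectProduct.rightHom SemidirectProduct.rightHom_surjective (SemidirectProduct.rightHom_inr _)
    (SemidirectProduct.inr (sr 0)) (SemidirectProduct.rightHom_inr _)

/-- **`μ = φ₂` for the split extensions `(N ⋊[φ] D₄, inr r²)`**, `|N| = 2ᵏ ≥ 4`, `r²` acting trivially: the least number of faces whose base changes
together with the pairs generate the Hodge lattice is the coinvariant fibre. [folklore] -/
theorem isLeast_card_gfaces_generate_semidirect (N : Type*) [Group N] [Fintype N] [DecidableEq N]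
    (φ : DihedralGroup 4 →* MulAut N) (hφ : φ (r 2) = 1) [Fintype (N ⋊[φ] DihedralGroup 4)] (k : ℕ) (hk : 2 ≤ k)
    (hN : Fintype.card N = 2 ^ k) :
    IsLeast {n : ℕ | ∃ S : Finset (CMF (N ⋊[φ] DihedralGroup 4) (SemidirectProduct.inr (r 2)) →₀ ℤ),
      (↑S ⊆ gfaceSet (N ⋊[φ] DihedralGroup 4) (SemidirectProduct.inr (r 2)) (semidirect_c_mul_c N φ)) ∧ S.card = n ∧
      hodgeSpan (SemidirectProduct.inr (r 2) : N ⋊[φ] DihedralGroup 4) (semidirect_c_mul_c N φ) ≤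
        Submodule.span ℤ (pairSet (SemidirectProduct.inr (r 2) : N ⋊[φ] DihedralGroup 4)) ⊔
          Submodule.span ℤ (translates (SemidirectProduct.inr (r 2) : N ⋊[φ] DihedralGroup 4) S)}
      (fibreTwo (SemidirectProduct.inr (r 2) : N ⋊[φ] DihedralGroup 4) (semidirect_c_mul_c N φ)) := by
  have hker : 4 ≤ Nat.card (SemidirectProduct.rightHom : N ⋊[φ] DihedralGroup 4 →* DihedralGroup 4).ker := by
    rw [semidirect_card_ker, hN]
    calc 4 = 2 ^ 2 := by norm_num
      _ ≤ 2 ^ k := Nat.pow_le_pow_right (by norm_num) hk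
  have hqq : (SemidirectProduct.inr (sr 0) : N ⋊[φ] DihedralGroup 4) * SemidirectProduct.inr (sr 0) = 1 := by
    rw [← map_mul, show (sr 0 : DihedralGroup 4) * sr 0 = 1 by decide, map_one]
  exact isLeast_card_gfaces_generate_of_dihedral_quotient (semidirect_isPGroup N φ k hN) (semidirect_c_mul_c N φ)
    (semidirect_c_central N φ hφ) SemidirectProduct.rightHom SemidirectProduct.rightHom_surjective (SemidirectProduct.rightHom_inr _)
    hker (SemidirectProduct.inr (sr 0)) (SemidirectProduct.rightHom_inr _) hqq

/-- **`μ = β − 2` for the split extensions `(N ⋊[φ] D₄, inr r²)`**, `|N| = 2ᵏ ≥ 4`, `r²` acting trivially: the census row reads «exactly `β − 2`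
generating faces». [folklore] -/
theorem isLeast_card_gfaces_generate_semidirect_block (N : Type*) [Group N] [Fintype N] [DecidableEq N]
    (φ : DihedralGroup 4 →* MulAut N) (hφ : φ (r 2) = 1) [Fintype (N ⋊[φ] DihedralGroup 4)] (k : ℕ) (hk : 2 ≤ k)
    (hN : Fintype.card N = 2 ^ k) :
    IsLeast {n : ℕ | ∃ S : Finset (CMF (N ⋊[φ] DihedralGroup 4) (SemidirectProduct.inr (r 2)) →₀ ℤ),
      (↑S ⊆ gfaceSet (N ⋊[φ] DihedralGroup 4) (SemidirectProduct.inr (r 2)) (semidirect_c_mul_c N φ)) ∧ S.card = n ∧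
      hodgeSpan (SemidirectProduct.inr (r 2) : N ⋊[φ] DihedralGroup 4) (semidirect_c_mul_c N φ) ≤
        Submodule.span ℤ (pairSet (SemidirectProduct.inr (r 2) : N ⋊[φ] DihedralGroup 4)) ⊔
          Submodule.span ℤ (translates (SemidirectProduct.inr (r 2) : N ⋊[φ] DihedralGroup 4) S)}
      (Fintype.card (Block (SemidirectProduct.inr (r 2) : N ⋊[φ] DihedralGroup 4)) - 2) := by
  have h := fibreTwo_add_two_eq_card_block_semidirect N φ hφ k hN
  rw [show Fintype.card (Block (SemidirectProduct.inr (r 2) : N ⋊[φ] DihedralGroup 4)) - 2 =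
    fibreTwo (SemidirectProduct.inr (r 2) : N ⋊[φ] DihedralGroup 4) (semidirect_c_mul_c N φ) by omega]
  exact isLeast_card_gfaces_generate_semidirect N φ hφ k hk hN

end

end Summit.HodgeConjecture.CorCM.Census.CentralSquares
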